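import Mathlib.Tactic.Linarith
import Mathlib.Tactic.Ring
import Mathlib.Tactic.NormNum
import HarnessLib

/-!
# The (0,1) cell of the ι-window, EXCLUSION side, VIII bis: CASE B on `M⁰` exists and is largely closed; arithmetic skeleton

Family `hodge`, b2b cell `hweil` (helper of item stmt-HodgeConjecture-2524). Companion to `WeilTypeLadderH2ClassZLoewyThree.lean` (same seat,
same dictionary: `A = k[[x₁,…,x₄]]` with odd coordinates, `M⁰ = Ae′ ⊕ 𝓘_Se₊ ⊂ E` with generators `h₁ = e′ (−)`, `h₂ = x₄e₊ (−)`, `h₃ = qe₊ (+)` and the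
relation `qh₂ − x₄h₃`, `T₀ = M⁰/F = V₊ ⊕ V₋` balanced of length `2n`, `(P) = hom^ι(M⁰,T₀) − end^ι(T₀) ≤ d(F)`; class Z with socle sign `σ`: `soc T₀ ⊂ V_σ`,
`F = A·F_τ`, and CASE B: `F ⊂ 𝔪M⁰`). Report `run/shared/lean/b2b/hodge-weil/b2b-hweil-pv1-g20/H2-ZERO-ONE-8.md` §3.10 (prover 1 gen 20).
Def-free ELEMENTARY statements (integer bookkeeping); the module theory is in the docstrings and the report.
HONEST FRAMING: a structure result about one cell of the ladder's H2 test on the exclusion side; no case of the Hodge conjecture is proved; nothing here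
is a rung; no statement of [Markman 2025] is used.

THE FACTS (report §3.10, §7.3). The kit census j078183 and the structured sampler `caseB_M0.py` produce balanced class-Z CASE-B points of
`Quot^ι_x(M⁰; 8,8)` (`σ = −`, gr-layers `(1,2)|(2,3)|(5,1)|(0,2)` and `(1,2)|(2,3)|(5,0)|(0,3)`), so CASE B is not empty on `M⁰`. At such a point
(`σ = −`, Loewy 4) the layers are `(1,2)|(p₁,3)|(p₂,e₂)|(0,e₃)` (`d₁ = 3` because `F₋ ⊂ 𝔪²M⁰`, `p₃ = 0` because `𝔪³T₀ ⊂ soc ⊂ V₋`); since `(𝔪³M⁰)₊ ⊂ F`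
the level-1 generators of `F` are `f_i = ℓ′_i·x₄e₊ + ℓ_i·e′ + τ_i` (`τ_i ∈ quad·qe₊`) with `e′`-coordinate EXACTLY the linear form `ℓ_i`; the free summand
`Ae′` makes every E-direction `ψ_{(0,t)}` (`e′ ↦ t ∈ V₋`, `𝓘_Se₊ ↦ 0`) a hom `M⁰ → T₀` with `res ψ_{(0,t)} = (ℓ_i(X)t)_i`, so `(P) ≥ r_E ≥ ρ :=` rank of
`t ↦ (ℓ_i(X)t)_i`; evaluating on lifts of `D₁ = (lin/x₄) ⊗ h₃` lands in `P₂ = S²(x₁,x₂,x₃)/W̄` (`dim W̄ = 6 − p₂`) through multiplication by `ℓ̄_i`, injective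
`S¹ → S²` when `ℓ_i ∉ k·x₄`: `ρ ≥ p₂ − 3`; and `dim span{ℓ_i} ≥ 4 − p₁`. Machine check (`check_310.py`): at 12/12 sampled points `ρ = 5`, the
`t₊`-directions restrict to zero, `(P) ∈ {8,9,10}`.
-/

-- mandated namespace `Summit.HodgeConjecture.HodgeConjecture.…` (Problem = Summit) trips `linter.dupNamespace`; the lakefile disables it
-- tree-wide (weak option), restated here so stand-alone elaboration is warning-free too.
set_option linter.dupNamespace false

namespace Summit.HodgeConjecture.HodgeConjecture.WeilTypeLadder

section H2ClassZM0CaseB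

/-- Admissible layer vectors of CASE B on `M⁰`, `σ = −` (report §3.10): balance `1 + p₁ + p₂ = 5 + e₂ + e₃`, parity filter `e₂ ≥ 4p₁ − 12`,
no-τ-socle `p₁ + p₂ ≤ 4(e₂ + e₃)`, and `p₂ ≤ 6`, `e₃ ≥ 1`, `p₁ ≥ 0` force `7 ≤ n ≤ 11`, `p₁ ≤ 4`, and for `p₁ ≤ 2`: `p₂ ≥ 4`, with
`p₂ = 4` only at `n = 7` (24 vectors in all; the observed ones are `(p₁,p₂,e₂,e₃) = (2,5,0,3)`, `(2,5,1,2)`, `n = 8`). [H2-ZERO-ONE-8 §3.10] -/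
theorem czlB0_admissible (n p₁ p₂ e₂ e₃ : ℤ) (h₁ : 0 ≤ p₁) (h₃ : 1 ≤ e₃) (h₄ : p₂ ≤ 6)
    (hbal₁ : n = 1 + p₁ + p₂) (hbal₂ : n = 5 + e₂ + e₃) (hpar : 4 * p₁ - 12 ≤ e₂)
    (hk₁ : p₁ + p₂ ≤ 4 * (e₂ + e₃)) :
    7 ≤ n ∧ n ≤ 11 ∧ p₁ ≤ 4 ∧ (p₁ ≤ 2 → 4 ≤ p₂) ∧ (p₁ ≤ 2 → p₂ = 4 → n = 7) := by
  refine ⟨by omega, by omega, by omega, fun _ => by omega, fun _ _ => by omega⟩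

/-- The closing inequality of report §3.10 (iii): `(P) ≥ r_E ≥ ρ ≥ p₂ − 3 ≥ 2` once `p₂ ≥ 5` — which covers every admissible vector with `p₁ ≤ 1`,
and `p₁ = 2` except `p₂ = 4` (`n = 7`); in particular the observed family `n = 8`, `(p₁,p₂) = (2,5)`. [H2-ZERO-ONE-8 §3.10] -/
theorem czlB0_closed (P rE ρ p₂ : ℤ) (hP : rE ≤ P) (hρ : ρ ≤ rE) (hmult : p₂ - 3 ≤ ρ) (h5 : 5 ≤ p₂) : 2 ≤ P := by
  omega

/-- The span `Λ` of the `e′`-coordinates of the `8 − p₁` level-1 generators of `F` inside `lin ⊗ {e′, x₄e₊} = k⁴ ⊕ k⁴` projects onto a subspace of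
`lin ⊗ e′ = k⁴` of dimension `≥ (8 − p₁) − 4`; so `p₁ ≤ 2` gives `dim Λ ≥ 2` (hence some `ℓ_i ∉ k·x₄`) and `p₁ ≤ 1` gives `dim Λ ≥ 3` (hence
`dim (Λ mod x₄) ≥ 2`, the hypothesis of §3.10 (iv)). [H2-ZERO-ONE-8 §3.10] -/
theorem czlB0_lambda (p₁ dimΛ : ℤ) (hΛ : (8 - p₁) - 4 ≤ dimΛ) :
    (p₁ ≤ 2 → 2 ≤ dimΛ) ∧ (p₁ ≤ 1 → 3 ≤ dimΛ) := by
  constructor <;> intro h <;> omega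

/-- E-P1g20-1 (2) (referee-g77 R424 / OBJECTION W-P1g20-310-a; filed by prover 1 gen 21, report `b2b-hweil-pv1-g21/H2-ZERO-ONE-9.md` §6.1):
`czlB0_admissible` above omits the report's hypothesis `p₂ ≤ 4e₃` (the no-τ-socle inequality at level 2), so ITS hypotheses admit 33 integer vectors
`(n,p₁,p₂,e₂,e₃)`, not the 24 its docstring announces; its five conclusions are true on all 33 (referee enumeration; `code/pv1-g21/czlB0_enum.py`). This
sharp twin carries the extra hypothesis `hk₂`; under it exactly 24 vectors remain (by `p₁ = 0,1,2,3,4`: 1, 3, 7, 12, 1 — the twelve with `p₁ = 3` are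
`(7,3,3,0,2), (7,3,3,1,1), (8,3,4,0,3), (8,3,4,1,2), (8,3,4,2,1), (9,3,5,0,4), (9,3,5,1,3), (9,3,5,2,2), (10,3,6,0,5), (10,3,6,1,4), (10,3,6,2,3),
(10,3,6,3,2)`), and the same five conclusions hold, together with the one consequence that needs `hk₂`: `e₃ = 1 → p₂ ≤ 4` (the nine
excluded vectors are exactly those with `e₃ = 1`, `p₂ ∈ {5,6}`). Nothing of record changes. [H2-ZERO-ONE-8 §3.10; H2-ZERO-ONE-9 §6.1] -/
theorem czlB0_admissible_sharp (n p₁ p₂ e₂ e₃ : ℤ) (h₁ : 0 ≤ p₁) (h₃ : 1 ≤ e₃) (h₄ : p₂ ≤ 6)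
    (hbal₁ : n = 1 + p₁ + p₂) (hbal₂ : n = 5 + e₂ + e₃) (hpar : 4 * p₁ - 12 ≤ e₂)
    (hk₁ : p₁ + p₂ ≤ 4 * (e₂ + e₃)) (hk₂ : p₂ ≤ 4 * e₃) :
    (7 ≤ n ∧ n ≤ 11 ∧ p₁ ≤ 4 ∧ (p₁ ≤ 2 → 4 ≤ p₂) ∧ (p₁ ≤ 2 → p₂ = 4 → n = 7)) ∧ (e₃ = 1 → p₂ ≤ 4) :=
  ⟨czlB0_admissible n p₁ p₂ e₂ e₃ h₁ h₃ h₄ hbal₁ hbal₂ hpar hk₁, fun h => by omega⟩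

end H2ClassZM0CaseB

end Summit.HodgeConjecture.HodgeConjecture.WeilTypeLadder
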